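import Literature.NumberTheory.Automorphic.Liu2021.AppendixC.OmegaHomBlockValues
import Literature.RingTheory.Idempotents.ArtinianBlockDecomposition
import HarnessLib

/-!
# [Liu 2021, p. 133 (D.3) / p. 140] the block PROJECTOR of an irreducible constituent: an honest quasi-idempotent `u₀` of `A_K` whose `ℓ`-adic transport is
# injective and carries the values `f′(ω^K)` (d6 S2′ row 3/9: the first conjuncts of `BlockShape′`)

Topic `NumberTheory/Automorphic/Liu2021/AppendixC`; namespace `Literature.NumberTheory.Automorphic.Liu2021.AppendixC.Sec42Data.HeckeTranslates`.
THEOREMS ONLY (no definition, no named fact, no instance, no `sorry`).  Assembly, BY NAME, of the cell's DH toolkit: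

1. the image of the Hecke algebra `heckeImage K` is finite-dimensional over `ℚ` (★ `HeckeImage`), hence left artinian with a BLOCK decomposition
   `1 = Σ c_i` into orthogonal centrally primitive idempotents (★ `ArtinianBlockDecomposition`) — NO semisimplicity input is needed for this file
   (S1 clause (3) enters only when the blocks are identified with isotypic components, i.e. in (4′));
2. for an IRREDUCIBLE `(W, ω)` and a non-zero `f′ ∈ Hom_𝔾(ι_ℓ ∘ ω, ℚ̄_ℓ ⊗ H¹_ét(A_∞))` exactly one block `ε = c_{i₀}` acts as `1` on the level-`K` classes under
   `f′(ω^K)` (★ `OmegaHomBlockSelector`);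
3. `ε = d⁻¹ (1 ⊗ u₀)` with `u₀` HONEST, `u₀ ≫ u₀ = d • u₀` (★ `HeckeImageProjector`);
4. the transport `([·]_K ∘ ᵗV_ℓ(A_K ↠ Im u₀)) ⊗ ℚ̄_ℓ` is INJECTIVE (★ `AbelianVarietyQuasiIdempotentImageDual` + flatness + ★ `toTower_injective`) and its range
   contains every value `f′ w`, `w ∈ ω^K` (★ `OmegaHomBlockValues`).

* `exists_blockProjector` — the statement 1–4 (the conjuncts `(K, u₀, a₀, a₀ ≠ 0, u₀ ≫ u₀ = a₀ • u₀, injective transport)` of the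
  cell's `BlockShape′`, plus the block datum `ε ∈ heckeImage K` (central, idempotent, `1 ⊗ u₀ = a₀ • ε`, selector identity) and (4a)).

Print: [Liu2021] p. 133 (D.3) «isogeny decomposition … of `C_c^∞(K\\G(𝔸^∞)/K, ℚ)`-modules», p. 140 «Using Hecke operators, we may find a surjective
homomorphism `ϕ : A_K → B` … such that `ϕ^* : H¹_B(B, ℚ) → H¹_B(A_K, ℚ)[π^∞]` is an isomorphism» (`B = Im u₀`, `ϕ = toImage u₀`).  The remaining
conjuncts of `BlockShape′` (the block FIELD `R₀ = Z·ε` of full degree, its positivity `ρ`, the label embedding `τ₀` and (4′)) carry the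
multiplicity-one / Rosati inputs and are not in this file.  Count-neutral (HC_CM is proved only modulo the 7 printed citations until rung 0 closes).

## References
* [Liu2021] Y. Liu, *Fourier–Jacobi cycles and arithmetic relative trace formula*, Camb. J. Math. 9 (2021): p. 133 (D.3) (FJcycle.tex l. 5463–5470), p. 140 (l. 5626).
* [Lam2001FirstCourse] T. Y. Lam, *A First Course in Noncommutative Rings*, §22 Prop. (22.1)–(22.2), pp. 327–328.
* [MumfordAV1970] D. Mumford, *Abelian Varieties*, §19 Thm. 3.
-/

set_option autoImplicit false

noncomputable section

open CategoryTheory NumberField Function MulAction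
open scoped TensorProduct

namespace Literature.NumberTheory.Automorphic.Liu2021.AppendixC

open Literature.AlgebraicGeometry.Motives (AbelianVariety)
open Literature.AlgebraicGeometry.Motives.AbelianVariety (rationalTateModuleMap endAlgebra rationalTateAction image toImage)

variable {F E : Type} [Field F] [NumberField F] [IsTotallyReal F] [Field E] [NumberField E] [Algebra F E]
  [IsTotallyComplex E] [Algebra.IsQuadraticExtension F E]
variable {P5 : PropC5Data F E} {isotropicAt : ℕ → Prop}

namespace Sec42Data.HeckeTranslates

variable {C : Sec42Data P5 isotropicAt} (T : C.HeckeTranslates) {ℓ : ℕ} [Fact ℓ.Prime]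
variable (K : C5.SmallLevel C.S.K₀)
  (hI : ∀ ⦃K K' : C5.SmallLevel C.S.K₀⦄ (f : K' ⟶ K), Function.Injective (rationalTateModuleMap ℓ (C.Atr f)).dualMap)
  (X : C.EtaleHeckeDatum ℓ) (hX : X.rhoEt = T.etHeckeRep ℓ) (ι : ℂ ≃+* AlgebraicClosure ℚ_[ℓ])
  {W : Type} [AddCommGroup W] [Module ℂ W] (ρW : Representation ℂ C.G W)
  {f : W →ₛₗ[(ι : ℂ →+* AlgebraicClosure ℚ_[ℓ])] AlgebraicClosure ℚ_[ℓ] ⊗[ℚ_[ℓ]] C.etaleH1Tower ℓ} (hf : f ∈ X.omegaHom ι ρW)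

include hI hX hf in
/-- **THE BLOCK PROJECTOR OF AN IRREDUCIBLE CONSTITUENT.**  If `(W, ω)` is irreducible and `f′ ∈ Hom_𝔾(ι_ℓ ∘ ω, ℚ̄_ℓ ⊗ H¹_ét(A_∞))` is non-zero on
`ω^K` (no semisimplicity input), then there are a central idempotent `ε` of `heckeImage K` acting as `1` on the level-`K` classes
under `f′(ω^K)`, and an HONEST `u₀ : A_K ⟶ A_K` with `1 ⊗ u₀ = a₀ • ε`, `u₀ ≫ u₀ = a₀ • u₀`, `a₀ ≠ 0`, whose transport `([·]_K ∘ ᵗV_ℓ(A_K ↠ Im u₀)) ⊗ ℚ̄_ℓ` is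
injective with every `f′ w`, `w ∈ ω^K`, in its range. [cite: Liu2021, p. 133 (D.3) and p. 140 (proof of Thm. D.6 (1), FJcycle.tex l. 5626)]
[cite: Lam2001FirstCourse, §22 Prop. (22.1)–(22.2), pp. 327–328] [cite: MumfordAV1970, §19 Thm. 3] -/
theorem exists_blockProjector (hD : T.IsogenyDescent) [ρW.IsIrreducible]
    (hf0 : ∃ w ∈ ρW.fixedPoints (K.1.1 : Subgroup C.G), f w ≠ 0) :
    ∃ (ε : (C.A K).endAlgebra) (u₀ : C.A K ⟶ C.A K) (a₀ : ℕ),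
      ε ∈ T.heckeImage hD K ∧ IsIdempotentElem ε ∧ (∀ x ∈ T.heckeImage hD K, x * ε = ε * x) ∧
      a₀ ≠ 0 ∧ endAlgebra.of (C.A K) u₀ = (a₀ : ℚ) • ε ∧ u₀ ≫ u₀ = a₀ • u₀ ∧
      (∀ w ∈ ρW.fixedPoints (K.1.1 : Subgroup C.G), ∀ x : (AlgebraicClosure ℚ_[ℓ]) ⊗[ℚ_[ℓ]] C.etaleH1 ℓ K,
        (C.toTower ℓ K).baseChange (AlgebraicClosure ℚ_[ℓ]) x = f w →
          (C.toTower ℓ K).baseChange (AlgebraicClosure ℚ_[ℓ])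
            (((rationalTateAction (C.A K) ℓ ε).dualMap).baseChange (AlgebraicClosure ℚ_[ℓ]) x) = f w) ∧
      Function.Injective ((C.toTower ℓ K ∘ₗ (rationalTateModuleMap ℓ (toImage u₀)).dualMap).baseChange (AlgebraicClosure ℚ_[ℓ])) ∧
      ∀ w ∈ ρW.fixedPoints (K.1.1 : Subgroup C.G),
        f w ∈ LinearMap.range ((C.toTower ℓ K ∘ₗ (rationalTateModuleMap ℓ (toImage u₀)).dualMap).baseChange (AlgebraicClosure ℚ_[ℓ])) := by
  classical
  -- 1. `heckeImage K` is finite-dimensional, hence artinian, hence has a block decomposition (no semisimplicity needed here)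
  haveI : Module.Finite ℚ ↥(T.heckeImage hD K) := T.module_finite_heckeImage hD K
  haveI : IsArtinianRing ↥(T.heckeImage hD K) := IsArtinianRing.of_finite ℚ _
  obtain ⟨r, c, hco, hcp⟩ := Literature.RingTheory.Idempotents.exists_block_decomposition (R := ↥(T.heckeImage hD K))
  -- the blocks as elements of `End⁰(A_K)`
  have hcoE : CompleteOrthogonalIdempotents fun i => ((c i : ↥(T.heckeImage hD K)) : (C.A K).endAlgebra) := by
    refine ⟨⟨fun i => ?_, fun i j hij => ?_⟩, ?_⟩
    · exact congrArg Subtype.val (hco.idem i).eq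
    · have := hco.ortho hij
      simpa using congrArg Subtype.val this
    · have h := congrArg Subtype.val hco.complete
      simpa using h
  have hzE : ∀ i, ∀ x ∈ T.heckeImage hD K, x * ((c i : ↥(T.heckeImage hD K)) : (C.A K).endAlgebra) = (c i : (C.A K).endAlgebra) * x :=
    fun i x hx => (congrArg Subtype.val ((hcp i).comm ⟨x, hx⟩)).symm
  -- 2. the selector
  obtain ⟨i₀, hi₀, -⟩ := T.existsUnique_block_baseChange_toTower_eq' K hI X hX ι ρW hf hD hf0 (fun i => (c i).2) hcoE hzE
  -- 3. the honest projector
  obtain ⟨a₀, u₀, ha₀, hu₀, huu, -, -, -⟩ :=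
    T.exists_hom_of_isIdempotentElem_of_mem_center_heckeImage hD K (c i₀).2 (congrArg Subtype.val (hco.idem i₀).eq ▸ (hcoE.idem i₀)) (hzE i₀)
  -- 4. injectivity of the transport and (4a)
  have hinj : Function.Injective ((C.toTower ℓ K ∘ₗ (rationalTateModuleMap ℓ (toImage u₀)).dualMap).baseChange (AlgebraicClosure ℚ_[ℓ])) := by
    rw [LinearMap.baseChange_comp]
    exact (toTower_baseChange_injective C ℓ (C.toTower_injective ℓ hI K)).comp
      (Module.Flat.lTensor_preserves_injective_linearMap (M := AlgebraicClosure ℚ_[ℓ]) _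
        (AbelianVariety.dualMap_rationalTateModuleMap_toImage_injective ℓ huu ha₀))
  refine ⟨(c i₀ : (C.A K).endAlgebra), u₀, a₀, (c i₀).2, hcoE.idem i₀, hzE i₀, ha₀, hu₀, huu, hi₀, hinj, fun w hw => ?_⟩
  exact T.apply_mem_range_toTower_comp_dualMap_toImage_baseChange K hI X hX ι ρW hf hD hi₀ ha₀ hu₀ hw

include hI hX hf in
/-- **Edition 2 (centrally primitive export).**  Same as `exists_blockProjector`, recording in addition that the block `ε` is a CENTRALLY
PRIMITIVE idempotent of `heckeImage K` (it is one of the blocks `c_i` of the artinian block decomposition `1 = Σ c_i` of `heckeImage K`) — the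
input of the block-field construction `R₀ = Z(heckeImage K)·ε` (★ `PositiveInvolutionCentreBlockField.exists_centreBlockField`).
[cite: Liu2021, p. 133 (D.3) and p. 140 (proof of Thm. D.6 (1), FJcycle.tex l. 5626)] [cite: Lam2001FirstCourse, §22 Prop. (22.1)–(22.2), pp. 327–328]
[cite: MumfordAV1970, §19 Thm. 3] -/
theorem exists_blockProjector' (hD : T.IsogenyDescent) [ρW.IsIrreducible]
    (hf0 : ∃ w ∈ ρW.fixedPoints (K.1.1 : Subgroup C.G), f w ≠ 0) :
    ∃ (ε : (C.A K).endAlgebra) (u₀ : C.A K ⟶ C.A K) (a₀ : ℕ) (hε : ε ∈ T.heckeImage hD K),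
      Literature.RingTheory.Idempotents.IsCentrallyPrimitive (⟨ε, hε⟩ : ↥(T.heckeImage hD K)) ∧
      IsIdempotentElem ε ∧ (∀ x ∈ T.heckeImage hD K, x * ε = ε * x) ∧
      a₀ ≠ 0 ∧ endAlgebra.of (C.A K) u₀ = (a₀ : ℚ) • ε ∧ u₀ ≫ u₀ = a₀ • u₀ ∧
      (∀ w ∈ ρW.fixedPoints (K.1.1 : Subgroup C.G), ∀ x : (AlgebraicClosure ℚ_[ℓ]) ⊗[ℚ_[ℓ]] C.etaleH1 ℓ K,
        (C.toTower ℓ K).baseChange (AlgebraicClosure ℚ_[ℓ]) x = f w →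
          (C.toTower ℓ K).baseChange (AlgebraicClosure ℚ_[ℓ])
            (((rationalTateAction (C.A K) ℓ ε).dualMap).baseChange (AlgebraicClosure ℚ_[ℓ]) x) = f w) ∧
      Function.Injective ((C.toTower ℓ K ∘ₗ (rationalTateModuleMap ℓ (toImage u₀)).dualMap).baseChange (AlgebraicClosure ℚ_[ℓ])) ∧
      ∀ w ∈ ρW.fixedPoints (K.1.1 : Subgroup C.G),
        f w ∈ LinearMap.range ((C.toTower ℓ K ∘ₗ (rationalTateModuleMap ℓ (toImage u₀)).dualMap).baseChange (AlgebraicClosure ℚ_[ℓ])) := by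
  classical
  haveI : Module.Finite ℚ ↥(T.heckeImage hD K) := T.module_finite_heckeImage hD K
  haveI : IsArtinianRing ↥(T.heckeImage hD K) := IsArtinianRing.of_finite ℚ _
  obtain ⟨r, c, hco, hcp⟩ := Literature.RingTheory.Idempotents.exists_block_decomposition (R := ↥(T.heckeImage hD K))
  have hcoE : CompleteOrthogonalIdempotents fun i => ((c i : ↥(T.heckeImage hD K)) : (C.A K).endAlgebra) := by
    refine ⟨⟨fun i => ?_, fun i j hij => ?_⟩, ?_⟩
    · exact congrArg Subtype.val (hco.idem i).eq
    · have := hco.ortho hij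
      simpa using congrArg Subtype.val this
    · have h := congrArg Subtype.val hco.complete
      simpa using h
  have hzE : ∀ i, ∀ x ∈ T.heckeImage hD K, x * ((c i : ↥(T.heckeImage hD K)) : (C.A K).endAlgebra) = (c i : (C.A K).endAlgebra) * x :=
    fun i x hx => (congrArg Subtype.val ((hcp i).comm ⟨x, hx⟩)).symm
  obtain ⟨i₀, hi₀, -⟩ := T.existsUnique_block_baseChange_toTower_eq' K hI X hX ι ρW hf hD hf0 (fun i => (c i).2) hcoE hzE
  obtain ⟨a₀, u₀, ha₀, hu₀, huu, -, -, -⟩ :=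
    T.exists_hom_of_isIdempotentElem_of_mem_center_heckeImage hD K (c i₀).2 (congrArg Subtype.val (hco.idem i₀).eq ▸ (hcoE.idem i₀)) (hzE i₀)
  have hinj : Function.Injective ((C.toTower ℓ K ∘ₗ (rationalTateModuleMap ℓ (toImage u₀)).dualMap).baseChange (AlgebraicClosure ℚ_[ℓ])) := by
    rw [LinearMap.baseChange_comp]
    exact (toTower_baseChange_injective C ℓ (C.toTower_injective ℓ hI K)).comp
      (Module.Flat.lTensor_preserves_injective_linearMap (M := AlgebraicClosure ℚ_[ℓ]) _
        (AbelianVariety.dualMap_rationalTateModuleMap_toImage_injective ℓ huu ha₀))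
  refine ⟨(c i₀ : (C.A K).endAlgebra), u₀, a₀, (c i₀).2, hcp i₀, hcoE.idem i₀, hzE i₀, ha₀, hu₀, huu, hi₀, hinj, fun w hw => ?_⟩
  exact T.apply_mem_range_toTower_comp_dualMap_toImage_baseChange K hI X hX ι ρW hf hD hi₀ ha₀ hu₀ hw

end Sec42Data.HeckeTranslates

end Literature.NumberTheory.Automorphic.Liu2021.AppendixC

end
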